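import Summits.ABC.ABC.Theses.IsogenyGlueCongruence
import Summits.ABC.ABC.Theorems.IsogenyGlueCongruencePolyDegreeOfBoundedPrimesMinimalBelow
import Literature.NumberTheory.EllipticCurves.DegreeConjectureAbcMurtyMinimalModelProofs

/-!
# Height calibration of crux B (`PolyDegreeOfBoundedPrimes`, stmt-ABC-2046, line `Sketch`)

Crux B of route IsogenyGlueCongruence is `A → P` with `A = DegreePrimesPolyBounded` and `P` the
polynomial modular-degree statement for semistable globally minimal elliptic `W/ℚ` in the tree's
`∃ D` idiom (`deg D ≤ C · N^κ` for some datum `D` at level `N = N_W`). The registered skeleton of the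
line `Sketch` splits `P` into the two open stubs DEPTH_A∣ and COUNT∣ and the tree already holds the
exactness theorem `B ↔ (A → DEPTH_A∣ ∧ COUNT∣)` (p97891). This file CALIBRATES the consequent `P` —
hence both residual stubs jointly — against the polynomial HEIGHT statement

  `H`: `∃ σ C, ∀` semistable globally minimal elliptic `W/ℚ`, `max(|Δ_W|, |c₄(W)|³) ≤ C · N_W^σ`

(Frey's height conjecture / polynomial Szpiro in Bombieri–Gubler's `max(|Δ|, |c₄|³)` form, exponent
free, restricted to semistable curves; `Δ_W = Δ_min` because `W` is globally minimal), using only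
theorems of the tree:

* `polyHeight_of_polyDegree` — **`P → H` unconditionally** (output exponent `σ = 7κ − 7/4`):
  Zagier's identity `4π² c² (f,f) = deg · covol(Λ)` (`zagier_degree_formula_holds`, PROVED), `c ≠ 0`
  (`maninConstant_ne_zero_holds`), the Hoffstein–Lockhart/Iwaniec lower bound `(f,f) ≫ N^{1/4}`
  (`HoffsteinLockhart1994_peterssonProduct_lower_bound_of_half_lt` at `η = 3/4`, PROVED) and
  Silverman's `max(|Δ|,|c₄|³) ≤ A · covol^{−7}` on global minimal models
  (`silverman1986_discriminant_c4_covolume_holds` at `ε = 1`, PROVED). This is Frey 1989 / Murty 1999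
  Thm 1 (i) run with a free exponent, for every semistable curve rather than for Frey curves.
* `polyDegree_of_polyHeight_of_manin` — **`H ∧ M → P` unconditionally**, where `M` says that every
  semistable globally minimal `W` has SOME datum at level `N_W` whose Manin constant is polynomially
  bounded, `|c_D| ≤ M₀ · N^a` (output exponent `κ = 2a + 3/2 + σ/6`): Murty 1999 Thm 1 (ii) / §2 with
  a free exponent — Zagier, the tree's Petersson UPPER bound at square-free level
  `(f,f) ≤ C · N (1 + log N)⁵` (`Automorphic.exists_petersson_le_mul_log_pow_of_squarefree`, PROVED),
  and Silverman's lower covolume inequality `covol^{−6} ≤ A · max(|c₄|³, |c₆|²)`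
  (`covolume_rpow_neg_six_le_of_isNeronLatticeOf`, PROVED) with `max(|c₄|³,|c₆|²) ≤ 1729 max(|Δ|,|c₄|³)`.
  `M` is known in print (modularity; Edixhoven 1991 `c ∈ ℤ`; Mazur 1978 / Abbes–Ullmo 1996 /
  Česnavičius 2018 `c = ±1` for the semistable optimal curve; Néron functoriality and Kenku 1982 inside
  the isogeny class give `|c| ≤ 163`) but is not a theorem of the tree; it is kept as a hypothesis.
* Corollaries for the crux: `polyHeight_of_polyDegreeOfBoundedPrimes` (**`B → A → H`**),
  `polyDegreeOfBoundedPrimes_of_polyHeight_of_manin` (**`H → M → B`**, hypothesis A idle) and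
  `polyDegreeOfBoundedPrimes_iff_of_manin` (**`M → (B ↔ (A → H))`**): modulo the fact-grade input `M`,
  crux B is EXACTLY "A implies the polynomial height conjecture for semistable curves", and the two
  open stubs DEPTH_A∣, COUNT∣ of the line are, granted A, jointly equivalent to `H`.

No new definition, no named fact; every statement is unfolded. Supports stmt-ABC-2046.

References: G. Frey, *Links between solutions of A − B = C and elliptic curves* (1989) (height
conjecture ⟺ degree conjecture); M. R. Murty, *Bounds for congruence primes* (1999), Thm 1 and §2;
H. Pasten, *Shimura curves and the abc conjecture*, J. Number Theory 254 (2024), §3, Conj. 3.1/3.2 and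
Rem. 3.3; J. Silverman, *Heights and elliptic curves* (1986), Prop. 1.1, Cor. 2.3.
-/

noncomputable section

-- single-conjunct summit ABC: the duplicate ABC.ABC is mandated (CONVENTIONS §2)
set_option linter.dupNamespace false

namespace Summit.ABC.ABC.Theorems

open Literature.NumberTheory.EllipticCurves Literature.NumberTheory.EllipticCurves.ModularForms
open CongruenceSubgroup
open Summit.ABC.ABC.Theses.IsogenyGlueCongruence

/-- `max(|c₄|³, |c₆|²) ≤ 1729 · max(|Δ|, |c₄|³)` for every Weierstrass equation over `ℚ`, from
`1728 Δ = c₄³ − c₆²` (Mathlib `WeierstrassCurve.c_relation`); rational twin of the tree's integral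
`max_abs_c₄_c₆_le`. [folklore] -/
theorem HeightCalibration.max_abs_c₄_c₆_le_rat (W : WeierstrassCurve ℚ) :
    max (|W.c₄| ^ 3) (|W.c₆| ^ 2) ≤ 1729 * max |W.Δ| (|W.c₄| ^ 3) := by
  have hrel := W.c_relation
  have hD : |W.Δ| ≤ max |W.Δ| (|W.c₄| ^ 3) := le_max_left _ _
  have h4 : |W.c₄| ^ 3 ≤ max |W.Δ| (|W.c₄| ^ 3) := le_max_right _ _
  have hM : 0 ≤ max |W.Δ| (|W.c₄| ^ 3) := le_trans (abs_nonneg _) hD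
  have h6 : |W.c₆| ^ 2 ≤ |W.c₄| ^ 3 + 1728 * |W.Δ| := by
    have heq : W.c₆ ^ 2 = W.c₄ ^ 3 - 1728 * W.Δ := by linear_combination hrel
    rw [← abs_pow, heq, ← abs_pow]
    calc |W.c₄ ^ 3 - 1728 * W.Δ| ≤ |W.c₄ ^ 3| + |1728 * W.Δ| := abs_sub _ _
      _ = |W.c₄ ^ 3| + 1728 * |W.Δ| := by rw [abs_mul]; norm_num
  refine max_le ?_ ?_
  · linarith
  · linarith

/-- **`P → H`: a polynomial modular degree bounds the height polynomially (Frey; Murty 1999 Thm 1 (i)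
with a free exponent, for every semistable curve).** If every semistable globally minimal elliptic
`W/ℚ` has a datum `D` at level `N_W` with `deg D ≤ C·N^κ`, then `max(|Δ_W|, |c₄(W)|³) ≤ C'·N^{7κ − 7/4}`
for all such `W`. Proof: Zagier `4π² c² (f,f) = deg·covol`, `c² ≥ 1`, `(f,f) ≥ c₂ N^{1/4}`
(Hoffstein–Lockhart range `η = 3/4`, tree theorem) give `covol ≥ (4π²c₂/C₁)·N^{−(κ − 1/4)}`
(`covolume_ge_of_zagier_exp`), and Silverman's `max(|Δ|,|c₄|³) ≤ A₀·covol^{−7}` on the global minimal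
model finishes. (Registered sub-goal of stmt-ABC-2046, line `Sketch`: name + one-line signature verbatim.)
[cite: MurtyCongruencePrimes1999, Thm. 1 (i) and §2] -/
theorem polyHeight_of_polyDegree : (∃ κ C : ℝ, ∀ (W : WeierstrassCurve ℚ) [W.IsElliptic] [W.IsGloballyMinimal] [NeZero (W.conductorNorm ℤ)], W.IsSemistable ℤ → ∃ D : Literature.NumberTheory.EllipticCurves.ModularForms.ModularParametrizationData W (W.conductorNorm ℤ), (D.modularDegree : ℝ) ≤ C * (W.conductorNorm ℤ : ℝ) ^ κ) → ∃ σ C : ℝ, ∀ (W : WeierstrassCurve ℚ) [W.IsElliptic] [W.IsGloballyMinimal] [NeZero (W.conductorNorm ℤ)], W.IsSemistable ℤ → ((max |W.Δ| (|W.c₄| ^ 3) : ℚ) : ℝ) ≤ C * (W.conductorNorm ℤ : ℝ) ^ σ := by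
  intro hP
  obtain ⟨κ, C, hP⟩ := hP
  obtain ⟨c₂, hc₂, hPet⟩ := HoffsteinLockhart1994_peterssonProduct_lower_bound_of_half_lt
    (show (1 : ℝ) / 2 < 3 / 4 by norm_num)
  obtain ⟨A₀, hA₀⟩ := silverman1986_discriminant_c4_covolume_holds 1 one_pos
  set C₁ : ℝ := max C 1 with hC₁def
  have hC₁ : 0 < C₁ := lt_of_lt_of_le one_pos (le_max_right _ _)
  set K : ℝ := 4 * Real.pi ^ 2 * c₂ / C₁ with hKdef
  have hK : 0 < K := by positivity
  refine ⟨(κ - 1 / 4) * (6 + 1), max A₀ 0 * K ^ (-(6 + 1 : ℝ)), ?_⟩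
  intro W _ _ _ hW
  obtain ⟨D, hD⟩ := hP W hW
  set N : ℕ := W.conductorNorm ℤ with hNdef
  have hN : (0 : ℝ) < N := by exact_mod_cast Nat.pos_of_ne_zero (NeZero.ne N)
  have hc : (D.c : ℝ) ≠ 0 := by exact_mod_cast D.maninConstant_ne_zero_holds
  have hcov : 0 < ZLattice.covolume D.L.lattice := ZLattice.covolume_pos _ _
  -- Zagier's identity, real form
  have hZ := congrArg Complex.re D.zagier_degree_formula_holds
  rw [Complex.re_ofReal_mul, Complex.ofReal_re] at hZ
  -- the degree bound in `c²`-form with exponent `2 + (κ − 2)`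
  have hdeg : (D.deg : ℝ) ≤ C₁ * (D.c : ℝ) ^ 2 * (N : ℝ) ^ (2 + (κ - 2)) := by
    have hc1 : (1 : ℝ) ≤ (D.c : ℝ) ^ 2 := by
      have h1 : (1 : ℤ) ≤ D.c ^ 2 := by
        have h0' : D.c ≠ 0 := D.maninConstant_ne_zero_holds
        nlinarith [Int.one_le_abs h0', sq_abs D.c]
      exact_mod_cast h1
    have hN0' : (0 : ℝ) ≤ (N : ℝ) ^ κ := by positivity
    rw [show 2 + (κ - 2) = κ by ring]
    calc (D.deg : ℝ) = (D.modularDegree : ℝ) := rfl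
      _ ≤ C * (N : ℝ) ^ κ := hD
      _ ≤ C₁ * (N : ℝ) ^ κ := mul_le_mul_of_nonneg_right (le_max_left _ _) hN0'
      _ = C₁ * 1 * (N : ℝ) ^ κ := by ring
      _ ≤ C₁ * (D.c : ℝ) ^ 2 * (N : ℝ) ^ κ :=
          mul_le_mul_of_nonneg_right (mul_le_mul_of_nonneg_left hc1 hC₁.le) hN0'
  -- covolume lower bound (the Manin constant cancels)
  have hlow := covolume_ge_of_zagier_exp hN hC₁ hc hcov hZ hdeg (hPet N W D)
  have hlow' : K * (N : ℝ) ^ (-(1 + (κ - 2) + 3 / 4)) ≤ ZLattice.covolume D.L.lattice := by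
    rw [hKdef]; exact hlow
  have hx : 0 < K * (N : ℝ) ^ (-(1 + (κ - 2) + 3 / 4)) := by positivity
  -- Silverman on the global minimal model `W`
  have hSW := hA₀ W D.L D.isNeronLattice
  have hpos : 0 ≤ ZLattice.covolume D.L.lattice ^ (-(6 + 1 : ℝ)) := Real.rpow_nonneg hcov.le _
  have h1 : ((max |W.Δ| (|W.c₄| ^ 3) : ℚ) : ℝ) ≤
      max A₀ 0 * ZLattice.covolume D.L.lattice ^ (-(6 + 1 : ℝ)) :=
    hSW.trans (mul_le_mul_of_nonneg_right (le_max_left _ _) hpos)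
  have h2 : ZLattice.covolume D.L.lattice ^ (-(6 + 1 : ℝ)) ≤
      (K * (N : ℝ) ^ (-(1 + (κ - 2) + 3 / 4))) ^ (-(6 + 1 : ℝ)) :=
    Real.rpow_le_rpow_of_nonpos hx hlow' (by norm_num)
  have h3 : (K * (N : ℝ) ^ (-(1 + (κ - 2) + 3 / 4))) ^ (-(6 + 1 : ℝ)) =
      K ^ (-(6 + 1 : ℝ)) * (N : ℝ) ^ ((κ - 1 / 4) * (6 + 1)) := by
    rw [Real.mul_rpow hK.le (Real.rpow_nonneg hN.le _), ← Real.rpow_mul hN.le]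
    congr 1
    ring_nf
  calc ((max |W.Δ| (|W.c₄| ^ 3) : ℚ) : ℝ)
      ≤ max A₀ 0 * ZLattice.covolume D.L.lattice ^ (-(6 + 1 : ℝ)) := h1
    _ ≤ max A₀ 0 * (K * (N : ℝ) ^ (-(1 + (κ - 2) + 3 / 4))) ^ (-(6 + 1 : ℝ)) :=
        mul_le_mul_of_nonneg_left h2 (le_max_right _ _)
    _ = max A₀ 0 * K ^ (-(6 + 1 : ℝ)) * (N : ℝ) ^ ((κ - 1 / 4) * (6 + 1)) := by
        rw [h3]; ring

/-- **`H ∧ M → P`: a polynomial height bound and polynomially bounded Manin constants bound the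
modular degree polynomially (Murty 1999 Thm 1 (ii) / §2 with a free exponent, for every semistable
curve).** If `max(|Δ_W|, |c₄(W)|³) ≤ C_H·N^σ` for every semistable globally minimal elliptic `W/ℚ`
and every such `W` has a datum `D` at level `N_W` with `|c_D| ≤ M₀·N^a`, then that datum has
`deg D ≤ C'·N^{2·max(a,0) + 3/2 + max(σ,0)/6}`. Proof: Zagier; `(f,f) ≤ C_P N (1 + log N)⁵ ≤ C₂ N^{3/2}`
at square-free level (tree theorem); `covol⁻¹ ≤ (1729 A C_H)^{1/6} N^{σ/6}` from Silverman's lower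
covolume inequality and `max(|c₄|³,|c₆|²) ≤ 1729·max(|Δ|,|c₄|³)`; `deg = 4π² c² (f,f)/covol`.
[cite: MurtyCongruencePrimes1999, Thm. 1 (ii) and §2] [cite: PastenShimura2024, Rem. 3.3] -/
theorem polyDegree_of_polyHeight_of_manin
    (hH : ∃ σ C : ℝ, ∀ (W : WeierstrassCurve ℚ) [W.IsElliptic] [W.IsGloballyMinimal]
      [NeZero (W.conductorNorm ℤ)], W.IsSemistable ℤ →
      ((max |W.Δ| (|W.c₄| ^ 3) : ℚ) : ℝ) ≤ C * (W.conductorNorm ℤ : ℝ) ^ σ)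
    (hM : ∃ a M₀ : ℝ, ∀ (W : WeierstrassCurve ℚ) [W.IsElliptic] [W.IsGloballyMinimal]
      [NeZero (W.conductorNorm ℤ)], W.IsSemistable ℤ →
      ∃ D : ModularParametrizationData W (W.conductorNorm ℤ),
        |(D.maninConstant : ℝ)| ≤ M₀ * (W.conductorNorm ℤ : ℝ) ^ a) :
    ∃ κ C : ℝ, ∀ (W : WeierstrassCurve ℚ) [W.IsElliptic] [W.IsGloballyMinimal]
      [NeZero (W.conductorNorm ℤ)], W.IsSemistable ℤ →
      ∃ D : ModularParametrizationData W (W.conductorNorm ℤ),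
        (D.modularDegree : ℝ) ≤ C * (W.conductorNorm ℤ : ℝ) ^ κ := by
  obtain ⟨σ, CH, hH⟩ := hH
  obtain ⟨a, M₀, hM⟩ := hM
  obtain ⟨A, hA, hSil⟩ := covolume_rpow_neg_six_le_of_isNeronLatticeOf
  obtain ⟨CP, hCP, hPet⟩ :=
    Literature.NumberTheory.Automorphic.exists_petersson_le_mul_log_pow_of_squarefree
  -- constants
  set B : ℝ := A * (1729 * max CH 0) with hB
  have hB0 : 0 ≤ B := by positivity
  have hhalf : (0 : ℝ) < 1 / 2 := by norm_num
  set C₂ : ℝ := CP * (5 / (1 / 2 : ℝ) + 1) ^ 5 with hC₂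
  have hC₂0 : 0 ≤ C₂ := by positivity
  set M : ℝ := max M₀ 0 with hMdef
  have hM0 : 0 ≤ M := le_max_right _ _
  set K : ℝ := 4 * Real.pi ^ 2 * M ^ 2 * C₂ * B ^ (1 / 6 : ℝ) with hK
  refine ⟨2 * max a 0 + (1 + 1 / 2) + max σ 0 / 6, K, fun W _ _ _ hss ↦ ?_⟩
  obtain ⟨D, hDc⟩ := hM W hss
  refine ⟨D, ?_⟩
  set N : ℕ := W.conductorNorm ℤ with hNdef
  have hNpos : (0 : ℝ) < N := by exact_mod_cast Nat.pos_of_ne_zero (NeZero.ne N)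
  have hN1 : (1 : ℝ) ≤ N := by exact_mod_cast Nat.pos_of_ne_zero (NeZero.ne N)
  have hsq : Squarefree N := (W.isSemistable_iff_squarefree_conductorNorm).mp hss
  -- Zagier's identity, real form
  have hZ := congrArg Complex.re D.zagier_degree_formula_holds
  rw [Complex.re_ofReal_mul, Complex.ofReal_re] at hZ
  have hP0 : 0 ≤ (peterssonProduct (Gamma0 N) 2 D.f D.f).re :=
    D.zagier_degree_formula_holds.peterssonProduct_re_pos.le
  have hcov : 0 < ZLattice.covolume D.L.lattice := ZLattice.covolume_pos _ _
  -- Petersson upper bound at square-free level: `(f,f) ≤ CP · N (1 + log N)⁵ ≤ C₂ N^{3/2}`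
  have hP : (peterssonProduct (Gamma0 N) 2 D.f D.f).re ≤ C₂ * (N : ℝ) ^ (1 + 1 / 2 : ℝ) := by
    have h1 := hPet N hsq W D.f D.isNewformOf
    have hlog : (1 + Real.log N) ^ 5 ≤ (5 / (1 / 2 : ℝ) + 1) ^ 5 * (N : ℝ) ^ (1 / 2 : ℝ) := by
      rw [add_comm]
      exact log_add_one_pow_five_le hN1 hhalf
    have hNrpow : (N : ℝ) * (N : ℝ) ^ (1 / 2 : ℝ) = (N : ℝ) ^ (1 + 1 / 2 : ℝ) := by
      rw [Real.rpow_add hNpos, Real.rpow_one]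
    calc (peterssonProduct (Gamma0 N) 2 D.f D.f).re ≤ CP * N * (1 + Real.log N) ^ 5 := h1
      _ ≤ CP * N * ((5 / (1 / 2 : ℝ) + 1) ^ 5 * (N : ℝ) ^ (1 / 2 : ℝ)) :=
          mul_le_mul_of_nonneg_left hlog (by positivity)
      _ = C₂ * ((N : ℝ) * (N : ℝ) ^ (1 / 2 : ℝ)) := by rw [hC₂]; ring
      _ = C₂ * (N : ℝ) ^ (1 + 1 / 2 : ℝ) := by rw [hNrpow]
  -- the height hypothesis: `max(|c₄|³,|c₆|²) ≤ 1729 · max(|Δ|,|c₄|³) ≤ 1729 · max CH 0 · N^{max σ 0}`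
  have hσ := hH W hss
  have hmax : ((max (|W.c₄| ^ 3) (|W.c₆| ^ 2) : ℚ) : ℝ) ≤
      1729 * max CH 0 * (N : ℝ) ^ (max σ 0) := by
    have h1 : ((max (|W.c₄| ^ 3) (|W.c₆| ^ 2) : ℚ) : ℝ) ≤ ((1729 * max |W.Δ| (|W.c₄| ^ 3) : ℚ) : ℝ) := by
      exact_mod_cast HeightCalibration.max_abs_c₄_c₆_le_rat W
    have hNσ : (N : ℝ) ^ σ ≤ (N : ℝ) ^ (max σ 0) :=
      Real.rpow_le_rpow_of_exponent_le hN1 (le_max_left _ _)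
    have hm0 : (0 : ℝ) ≤ ((max |W.Δ| (|W.c₄| ^ 3) : ℚ) : ℝ) := by
      exact_mod_cast le_trans (abs_nonneg _) (le_max_left _ _)
    have h2 : ((max |W.Δ| (|W.c₄| ^ 3) : ℚ) : ℝ) ≤ max CH 0 * (N : ℝ) ^ (max σ 0) :=
      calc ((max |W.Δ| (|W.c₄| ^ 3) : ℚ) : ℝ) ≤ CH * (N : ℝ) ^ σ := hσ
        _ ≤ max CH 0 * (N : ℝ) ^ σ := mul_le_mul_of_nonneg_right (le_max_left _ _) (by positivity)
        _ ≤ max CH 0 * (N : ℝ) ^ (max σ 0) := mul_le_mul_of_nonneg_left hNσ (le_max_right _ _)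
    calc ((max (|W.c₄| ^ 3) (|W.c₆| ^ 2) : ℚ) : ℝ)
        ≤ ((1729 * max |W.Δ| (|W.c₄| ^ 3) : ℚ) : ℝ) := h1
      _ = 1729 * ((max |W.Δ| (|W.c₄| ^ 3) : ℚ) : ℝ) := by push_cast; ring
      _ ≤ 1729 * (max CH 0 * (N : ℝ) ^ (max σ 0)) := mul_le_mul_of_nonneg_left h2 (by norm_num)
      _ = 1729 * max CH 0 * (N : ℝ) ^ (max σ 0) := by ring
  -- Silverman: `covol^{-6} ≤ A · max(|c₄|³,|c₆|²) ≤ B · (N^{max σ 0 / 6})⁶`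
  have hpow : (N : ℝ) ^ (max σ 0) = ((N : ℝ) ^ (max σ 0 / 6)) ^ 6 := by
    rw [← Real.rpow_natCast, ← Real.rpow_mul hNpos.le]
    congr 1
    push_cast
    ring
  have h6 : ZLattice.covolume D.L.lattice ^ (-(6 : ℝ)) ≤ B * ((N : ℝ) ^ (max σ 0 / 6)) ^ 6 := by
    calc ZLattice.covolume D.L.lattice ^ (-(6 : ℝ))
        ≤ A * ((max (|W.c₄| ^ 3) (|W.c₆| ^ 2) : ℚ) : ℝ) := hSil W D.L D.isNeronLattice
      _ ≤ A * (1729 * max CH 0 * (N : ℝ) ^ (max σ 0)) := mul_le_mul_of_nonneg_left hmax hA.le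
      _ = B * ((N : ℝ) ^ (max σ 0 / 6)) ^ 6 := by rw [hB, hpow]; ring
  have hinv := inv_le_of_rpow_neg_six_le hcov hB0 (by positivity) h6
  -- the Manin constant: `|c| ≤ M₀ N^a ≤ M · N^{max a 0}`
  have hcM : |(D.c : ℝ)| ≤ M * (N : ℝ) ^ (max a 0) := by
    have hNa : (N : ℝ) ^ a ≤ (N : ℝ) ^ (max a 0) :=
      Real.rpow_le_rpow_of_exponent_le hN1 (le_max_left _ _)
    calc |(D.c : ℝ)| = |(D.maninConstant : ℝ)| := rfl
      _ ≤ M₀ * (N : ℝ) ^ a := hDc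
      _ ≤ M * (N : ℝ) ^ a := mul_le_mul_of_nonneg_right (le_max_left _ _) (by positivity)
      _ ≤ M * (N : ℝ) ^ (max a 0) := mul_le_mul_of_nonneg_left hNa hM0
  -- the degree bound
  have hdeg := deg_le_of_zagier_of_upper hcov hZ hcM hP0 hP hinv
  have hexp : ((N : ℝ) ^ (max a 0)) ^ 2 * (N : ℝ) ^ (1 + 1 / 2 : ℝ) * (N : ℝ) ^ (max σ 0 / 6) =
      (N : ℝ) ^ (2 * max a 0 + (1 + 1 / 2) + max σ 0 / 6) := by
    have h2 : ((N : ℝ) ^ (max a 0)) ^ 2 = (N : ℝ) ^ (2 * max a 0) := by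
      rw [← Real.rpow_natCast, ← Real.rpow_mul hNpos.le]
      congr 1
      push_cast
      ring
    rw [h2, ← Real.rpow_add hNpos, ← Real.rpow_add hNpos]
  calc (D.modularDegree : ℝ) = (D.deg : ℝ) := rfl
    _ ≤ 4 * Real.pi ^ 2 * (M * (N : ℝ) ^ (max a 0)) ^ 2 * (C₂ * (N : ℝ) ^ (1 + 1 / 2 : ℝ)) *
          (B ^ (1 / 6 : ℝ) * (N : ℝ) ^ (max σ 0 / 6)) := hdeg
    _ = K * (((N : ℝ) ^ (max a 0)) ^ 2 * (N : ℝ) ^ (1 + 1 / 2 : ℝ) * (N : ℝ) ^ (max σ 0 / 6)) := by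
          rw [hK]; ring
    _ = K * (N : ℝ) ^ (2 * max a 0 + (1 + 1 / 2) + max σ 0 / 6) := by rw [hexp]

/-! ## Corollaries for crux B -/

/-- **`B → A → H`**: crux B (granted its hypothesis A) yields the polynomial height conjecture for
semistable curves — so B is at least as strong as "prime SIZES of the modular degree ⟹ polynomial
Szpiro". Composition of the crux with `polyHeight_of_polyDegree`. [folklore] -/
theorem polyHeight_of_polyDegreeOfBoundedPrimes (hB : PolyDegreeOfBoundedPrimes)
    (hA : DegreePrimesPolyBounded) :
    ∃ σ C : ℝ, ∀ (W : WeierstrassCurve ℚ) [W.IsElliptic] [W.IsGloballyMinimal]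
      [NeZero (W.conductorNorm ℤ)], W.IsSemistable ℤ →
      ((max |W.Δ| (|W.c₄| ^ 3) : ℚ) : ℝ) ≤ C * (W.conductorNorm ℤ : ℝ) ^ σ :=
  polyHeight_of_polyDegree (hB hA)

/-- **`H → M → B`**: the polynomial height conjecture for semistable curves together with
polynomially bounded Manin constants proves crux B (its hypothesis A is then idle).
Composition of `polyDegree_of_polyHeight_of_manin` with `B = (A → P)`. [folklore] -/
theorem polyDegreeOfBoundedPrimes_of_polyHeight_of_manin
    (hH : ∃ σ C : ℝ, ∀ (W : WeierstrassCurve ℚ) [W.IsElliptic] [W.IsGloballyMinimal]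
      [NeZero (W.conductorNorm ℤ)], W.IsSemistable ℤ →
      ((max |W.Δ| (|W.c₄| ^ 3) : ℚ) : ℝ) ≤ C * (W.conductorNorm ℤ : ℝ) ^ σ)
    (hM : ∃ a M₀ : ℝ, ∀ (W : WeierstrassCurve ℚ) [W.IsElliptic] [W.IsGloballyMinimal]
      [NeZero (W.conductorNorm ℤ)], W.IsSemistable ℤ →
      ∃ D : ModularParametrizationData W (W.conductorNorm ℤ),
        |(D.maninConstant : ℝ)| ≤ M₀ * (W.conductorNorm ℤ : ℝ) ^ a) :
    PolyDegreeOfBoundedPrimes :=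
  fun _ ↦ polyDegree_of_polyHeight_of_manin hH hM

/-- **Calibration of crux B: `M → (B ↔ (A → H))`.** Modulo polynomially bounded Manin constants
(known in print: modularity, Edixhoven, Mazur/Abbes–Ullmo/Česnavičius, Kenku), crux B is EQUIVALENT
to "crux A implies the polynomial height conjecture (Frey 1989; Pasten 2024 Conj. 3.1) for semistable
curves"; with the tree's exactness theorem `polyDegreeOfBoundedPrimes_iff_excessDepth_and_truncatedMass`
(p97891) the two open stubs DEPTH_A∣ ∧ COUNT∣ of the line `Sketch` are, granted A and `M`, jointly
equivalent to `H`. [folklore] -/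
theorem polyDegreeOfBoundedPrimes_iff_of_manin
    (hM : ∃ a M₀ : ℝ, ∀ (W : WeierstrassCurve ℚ) [W.IsElliptic] [W.IsGloballyMinimal]
      [NeZero (W.conductorNorm ℤ)], W.IsSemistable ℤ →
      ∃ D : ModularParametrizationData W (W.conductorNorm ℤ),
        |(D.maninConstant : ℝ)| ≤ M₀ * (W.conductorNorm ℤ : ℝ) ^ a) :
    PolyDegreeOfBoundedPrimes ↔ (DegreePrimesPolyBounded →
      ∃ σ C : ℝ, ∀ (W : WeierstrassCurve ℚ) [W.IsElliptic] [W.IsGloballyMinimal]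
        [NeZero (W.conductorNorm ℤ)], W.IsSemistable ℤ →
        ((max |W.Δ| (|W.c₄| ^ 3) : ℚ) : ℝ) ≤ C * (W.conductorNorm ℤ : ℝ) ^ σ) :=
  ⟨fun hB hA ↦ polyHeight_of_polyDegree (hB hA),
    fun h hA ↦ polyDegree_of_polyHeight_of_manin (h hA) hM⟩

/-! ## The two open stubs of the line against `H` -/

/-- **`A → DEPTH_A∣ → COUNT∣ → H`**: the two open registered stubs of the line `Sketch`
(`stub_excessDepthBelow`, `stub_truncatedMassBelow`, verbatim as hypotheses) together with crux A
imply the polynomial height conjecture for semistable curves — through the landed glue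
(`stub_primePowersExist_of_degreePrimes_of_excessDepth`, p96116; `stub_polyDegree_of_depthExists_of_count`,
p87649) and `polyHeight_of_polyDegree`. [folklore] -/
theorem polyHeight_of_degreePrimes_of_excessDepth_of_truncatedMass (hA : DegreePrimesPolyBounded)
    (hX : ∃ κ C : ℝ, ∀ (W : WeierstrassCurve ℚ) [W.IsElliptic] [W.IsGloballyMinimal] [NeZero (W.conductorNorm ℤ)], W.IsSemistable ℤ → ∀ D₀ : Literature.NumberTheory.EllipticCurves.ModularForms.ModularParametrizationData W (W.conductorNorm ℤ), ∃ D : Literature.NumberTheory.EllipticCurves.ModularForms.ModularParametrizationData W (W.conductorNorm ℤ), D.modularDegree ∣ D₀.modularDegree ∧ ∀ ℓ ∈ (D.modularDegree).primeFactors, ((ℓ ^ ((D.modularDegree).factorization ℓ - 1) : ℕ) : ℝ) ≤ C * (W.conductorNorm ℤ : ℝ) ^ κ)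
    (hC : ∃ κ C : ℝ, ∀ (W : WeierstrassCurve ℚ) [W.IsElliptic] [W.IsGloballyMinimal] [NeZero (W.conductorNorm ℤ)], W.IsSemistable ℤ → ∀ D₀ : Literature.NumberTheory.EllipticCurves.ModularForms.ModularParametrizationData W (W.conductorNorm ℤ), ∃ D : Literature.NumberTheory.EllipticCurves.ModularForms.ModularParametrizationData W (W.conductorNorm ℤ), D.modularDegree ∣ D₀.modularDegree ∧ (∑ ℓ ∈ (D.modularDegree).primeFactors, min (((D.modularDegree).factorization ℓ : ℝ) * Real.log ℓ) (Real.log (W.conductorNorm ℤ : ℝ))) ≤ κ * Real.log (W.conductorNorm ℤ : ℝ) + C) :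
    ∃ σ C : ℝ, ∀ (W : WeierstrassCurve ℚ) [W.IsElliptic] [W.IsGloballyMinimal]
      [NeZero (W.conductorNorm ℤ)], W.IsSemistable ℤ →
      ((max |W.Δ| (|W.c₄| ^ 3) : ℚ) : ℝ) ≤ C * (W.conductorNorm ℤ : ℝ) ^ σ :=
  polyHeight_of_polyDegree (stub_polyDegree_of_depthExists_of_count
    (stub_primePowersExist_of_degreePrimes_of_excessDepth hA hX) hC)

/-- **`H → M → DEPTH_A∣ ∧ COUNT∣`**: conversely the polynomial height conjecture with polynomially
bounded Manin constants implies both open stubs of the line (through `polyDegree_of_polyHeight_of_manin`,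
`P → P∣` = `stub_polyDegreeBelow_of_polyDegree`, p97891, and its riders). So, granted A and `M`, the
pair of open stubs is equivalent to `H`. [folklore] -/
theorem excessDepth_and_truncatedMass_of_polyHeight_of_manin
    (hH : ∃ σ C : ℝ, ∀ (W : WeierstrassCurve ℚ) [W.IsElliptic] [W.IsGloballyMinimal]
      [NeZero (W.conductorNorm ℤ)], W.IsSemistable ℤ →
      ((max |W.Δ| (|W.c₄| ^ 3) : ℚ) : ℝ) ≤ C * (W.conductorNorm ℤ : ℝ) ^ σ)
    (hM : ∃ a M₀ : ℝ, ∀ (W : WeierstrassCurve ℚ) [W.IsElliptic] [W.IsGloballyMinimal]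
      [NeZero (W.conductorNorm ℤ)], W.IsSemistable ℤ →
      ∃ D : ModularParametrizationData W (W.conductorNorm ℤ),
        |(D.maninConstant : ℝ)| ≤ M₀ * (W.conductorNorm ℤ : ℝ) ^ a) :
    (∃ κ C : ℝ, ∀ (W : WeierstrassCurve ℚ) [W.IsElliptic] [W.IsGloballyMinimal] [NeZero (W.conductorNorm ℤ)], W.IsSemistable ℤ → ∀ D₀ : Literature.NumberTheory.EllipticCurves.ModularForms.ModularParametrizationData W (W.conductorNorm ℤ), ∃ D : Literature.NumberTheory.EllipticCurves.ModularForms.ModularParametrizationData W (W.conductorNorm ℤ), D.modularDegree ∣ D₀.modularDegree ∧ ∀ ℓ ∈ (D.modularDegree).primeFactors, ((ℓ ^ ((D.modularDegree).factorization ℓ - 1) : ℕ) : ℝ) ≤ C * (W.conductorNorm ℤ : ℝ) ^ κ) ∧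
    (∃ κ C : ℝ, ∀ (W : WeierstrassCurve ℚ) [W.IsElliptic] [W.IsGloballyMinimal] [NeZero (W.conductorNorm ℤ)], W.IsSemistable ℤ → ∀ D₀ : Literature.NumberTheory.EllipticCurves.ModularForms.ModularParametrizationData W (W.conductorNorm ℤ), ∃ D : Literature.NumberTheory.EllipticCurves.ModularForms.ModularParametrizationData W (W.conductorNorm ℤ), D.modularDegree ∣ D₀.modularDegree ∧ (∑ ℓ ∈ (D.modularDegree).primeFactors, min (((D.modularDegree).factorization ℓ : ℝ) * Real.log ℓ) (Real.log (W.conductorNorm ℤ : ℝ))) ≤ κ * Real.log (W.conductorNorm ℤ : ℝ) + C) := by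
  have hP := stub_polyDegreeBelow_of_polyDegree (polyDegree_of_polyHeight_of_manin hH hM)
  exact ⟨MinimalBelow.excessDepthBelow_of_polyDegreeBelow hP,
    MinimalBelow.truncatedMassBelow_of_polyDegreeBelow hP⟩

end Summit.ABC.ABC.Theorems

end
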